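/-
Copyright (c) 2026 the pub-hodgecm-mathlib formalisation cell (harness21).  R90-TF SLAB, section S10 (Rogawski 1990, §13.6–13.8 read at `v`),
prover R90-C138-p07 (g2) — DEAL #37′ THE S10 KEYSTONE (R90-C138-plan (g3) 2026-09-05T02:33:09Z, re-dealt from p08 (g0); p08's census `CENSUS-DEAL37-keystone.md`
a9b4ce56 plan K1; typ4 (g2)'s binder table `keystone_binders.v1.lean` 8dfc62d6); h413 = `stmt-HodgeConjecture-24833`, route `HCCMUnconditional`.
-/
import Summits.HodgeConjecture.HodgeConjecture.Theorems.R90S10RigidityAtGermOfLetters        -- ★ (this seat) DEAL #26 glue: (P-rig) `rigidityAtGermLetter_subtype_of_exists_liesOver` from the ∃-form `hex`; brings ★ (J1)(J2), ★ W1-H2′, ★ S5 AFA∕12R3, ★ C2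
import Summits.HodgeConjecture.HodgeConjecture.Theorems.R90S10GermOfMembersOfBC             -- ★ p864664 (K2Liu-p13 DEAL #42): (P-t₀) `germOfMembersLetter_of_bcSpherical` from `hbc`
import Summits.HodgeConjecture.HodgeConjecture.Theorems.R90S10GermOfRecordMem               -- ★ p863389 (this seat, g0): `germOfDiscreteClass_mem_germSub` at the pins of record `bdRec`∕`σRec` (+ ★ `σRec_one`)
import Summits.HodgeConjecture.HodgeConjecture.Theorems.R90S10DiscreteGermCoeffDefs          -- ★ DEAL #50 (K2Liu-p13; typ2 D8-1 bytes): `cDOf` — the discrete germ coefficient OF RECORD (kept OPAQUE here: its body's `toAdelic` is `cmDatum`-typed, `classTrace` `G3`-typed)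
import Summits.HodgeConjecture.HodgeConjecture.Theorems.R90S10UnrHatPinsOfRestricted         -- ★ p862102: the five Langlands separation pins `unrHatPins_of_restricted` (D3-pins DISCHARGED)
import Summits.HodgeConjecture.HodgeConjecture.Theorems.R90S10FrozenDatumTwoPlaceDefs         -- ★ C2₂: `S10FrozenDatum₂`, `toS10FrozenDatum` (the two-place datum of the socket of record)
import Literature.NumberTheory.Rogawski1990.StabilisationIdentities                           -- ★ `StabilisationData` (`θG`, `SθH`: the stabilisation carrier `𝔖` of FILE D, S6∕S8's parameter)
import Literature.Topology.SummableDiracCombSeparation                                       -- ★ `Literature.Topology.separation_of_injective_bounded_starClosed` (Langlands: «separating by Hecke eigenvalues»)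
import HarnessLib

/-!
# R90-TF ∕ S10 — THE KEYSTONE: THE STABILISED IDENTITY AT THE E.V.P. `t₀` (13.8.3) FOR A TWO-PLACE FROZEN DATUM, FROM ITS NAMED INPUTS
# (`Theorems/R90S10StabilisedAtEvp2OfInputs.lean`; ns `Summit.HodgeConjecture.HodgeConjecture.R90.S10`; THEOREMS ONLY — no `def`, no instance, no notation, 0 `sorry`; LAW L9)

Print: [Rogawski1990] §13.8 display (13.8.3) p. 218 L5–7 «`2 Σ m(π) Tr(π(f)) − Tr(ρ(f^H)) = …` … the sum is over cuspidal `π` on `G` such that `ψ_G(t(π)) = t`», p. 218 L20–L28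
(the frozen test vectors, `f` cuspidal at two places so the simple trace formula holds), p. 219 L2–L3; §13.6 (13.6.1) p. 208, Props. 13.6.1–13.6.2 pp. 209–210, Lemma 13.6.3 p. 210;
§13.7 p. 211 («separating by Hecke eigenvalues»); §10.3 p. 159, Thm. 10.3.1 (b) p. 160.  [Langlands1980] pp. 208–211.  [Arthur1988InvariantTraceFormulaII] Thm. 7.1 p. 538.

## WHAT THIS FILE IS (dealer RULING J-K1: the payer of Lines B's socket of record `sock_S10_stabilisedAtEvp₂ 𝔣 : Sock₂Sig 𝔣` is a ★ THEOREMS file stating `Sock₂Sig 𝔣`'s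
## BODY unfolded to ★ tokens, with FILE D's block BODIES as hypotheses — Theorems never import `Cruxes/…/Lines`)
`Sock₂Sig 𝔣` (Lines B §3) unfolds through `StabilisedAtEvpHyp` (Lines C) and `mOf`∕`trGPinned`∕`trHPinned` (B §0) ∕ `classTraceAt`∕`weightedCutSum` (C §2) to
  `∀ (f^H_v, φ)` matched (★ `MatchE1`), `Σᶠ_i m(π_i) · Tr [P i](𝔳.ΦG φ) = ½ · Σᶠ_j m(ρ_j) · Tr ρ_j(𝔳.ΦH f^H_v)`
over the `G`-cut `𝔣.𝔤` and the packet cut `𝔥.dρ` — THE CONCLUSION of `stabilisedAtEvp_of_inputs` ∕ `sock₂Sig_of_inputs` below, token for token (junction certificate: the dealer's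
paste-probe `example … : Sock₂Sig 𝔣 := sock₂Sig_of_inputs …` in a scratch importing Lines B, posted with the REPORT-FIRST).
THE COMPOSITION is FILE D's ED. 2 two-place head `stabilisedAtEvp_of_tfBlocks₂` (§3+§5: (D1)₂ stabilised vanishing on the frozen family, (D2) the germ expansion of
`SΘ_G = θ_G − ½ SΘ_H` assembled from the discrete expansion `hd` (θ_G IS its discrete part on the two-place-cuspidal family, `hθ`, continuous term `0`) and the `H`-expansion `hH`,
(D3) Langlands separation — ★ `separation_of_injective_bounded_starClosed` with the five pins ★ `unrHatPins_of_restricted` — and (D4) the two coefficient readings at `t₀`)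
RE-PROVED INLINE in body currency (≈ 40 lines; D is the script), with:
* (D4-d) `hd4` PAID: ★ W1-H2′ `discreteCoeffAtT0_frozenFamily_unrUnit_of_letters` (p864471) at the germ coefficient OF RECORD `cD t φ := Σ'_{c : evp c = t} m(c) · Tr c(toAdelic (𝔳.ΦGu S e φ))`
  (typ2's (D8-1) `cDOf` body; `evp c := ⟨germOfDiscreteClass S c, hRepGerm c⟩`), modulo the two e.v.p. pins —
* (P-t₀) PAID BY NAME: ★ `germOfMembersLetter_of_bcSpherical 𝔣' S hv hRepGerm t₀ hbc` (K2Liu-p13 #42) from the by-value binder `hbc` («every `U(Φ₃)(𝒪_w)`-spherical class LYING OVER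
  `ρ_w` has Hecke character `(t₀)_w`», Prop. 4.9.1 (b) + Satake; bottom per dealer RULING J-PIN: S6's floor `StubR90ExtE1HeckeFL` at inert `w`);
* (P-rig) PAID BY NAME: ★ `rigidityAtGermLetter_subtype_of_exists_liesOver hunr 𝔣' hAF S hv hS hRepGerm t₀ hex` (this seat's DEAL #26 glue) from ⟪U⟫ `hunr`, «AFA» (★ from E1's 12R3
  `h12` by ★ `R90.S5.automorphicFlathAdmissible_qs_of_residualCompactR`) and the by-value ∃-form `hex` («at every `w ≠ v`, `ξ_H(ρ_w)` EXISTS as an admissible `U(Φ₃)(𝒪_w)`-spherical class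
  of character `(t₀)_w` lying over `ρ_w`» — supplier p01's ★ ∃-bridge + (β″)∕(3′) payers + the PIN, read through ★ `exists_liesOver_frozen_of_pinnedPartner`).

## CONTENTS (all ★-backed; TRIO)
* §0 `eq_half_mul_of_tfBlocks` — FILE D's §3+§5 (`stabilisedAtEvp_of_tfBlocks₂`) as ONE abstract lemma over germs ∕ tests ∕ `hat` (D1)₂ + `θ_G = dG` + two germ expansions + five pins + two readings ⟹ `D = ½ H`.
* §1 `stabilisedAtEvp_of_inputs` — the CORE for an ED. 1 frozen datum `𝔣' : S10FrozenDatum …` at a level `S` (`v ∈ S ⊆ {v}`) and FILE D's twin's germs `EvpGerm S (HeckeQs L) bd σ`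
  (bounded by `bd`, star-fixed under `σ`; the five (D3) pins DISCHARGED inside by ★ `unrHatPins_of_restricted S (HeckeQs L) bd σ hσ`); conclusion = B1's body at `𝔣'`.
* §2 **`sock₂Sig_of_inputs`** — THE KEYSTONE for a two-place datum `𝔣 : S10FrozenDatum₂ … CuspG CuspH` (any cusp-pin instance; the socket of record is `S2.CuspG₀ ∕ S2.CuspH₀`), keyed on
  E1's 12R3 binder `h12` (AFA by ★ S5) — conclusion = `Sock₂Sig 𝔣` unfolded at `𝔣.toS10FrozenDatum` (§1 at `𝔣' := 𝔣.toS10FrozenDatum`).  (The record-pinned instance `bd := bdRec`, `σ := σRec`, `hσ := σRec_one`, `hRepGerm := germOfDiscreteClass_mem_germSub S` — ★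
  `R90S10GermPinsOfRecordDefs` ∕ ★ p863389 — is a term-level instantiation left to the consumer, J-D7-3.)
EXTERNAL BINDERS (each named for its payer; typ4's table 8dfc62d6 types): `hunr` (A's ⟪U⟫), `h12` (E1 12R3), `hD1` (S6: two-place stabilised vanishing), `hθ` (S8 (V-G)), `hd` (p04∕p03
row 3: the discrete germ expansion at `cDOf`), `hH`, `hH4` (S5: Prop. 13.6.1 ∕ Lemma 13.6.3 (a)(b)), `hbc` (FL-spherical-class input, J-PIN), `hex` (the ∃-form PIN road); PARAMETERS
`S hv hS bd σ hσ hRepGerm {TH} 𝔖 ΦHu dG cH t₀` (J-D5-1 (c): `𝔖 := ⟨S8 θ_G, S6 SΘ_H, …⟩` and `t₀ :=` S5's `ξ_H`-image of `t(ρ)` are named by their payers).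
HONEST LABEL: ★ helper (`--supports stmt-HodgeConjecture-24833 --as helper`); the keystone PAYS `Sock₂Sig 𝔣` ONLY MODULO its nine named by-value inputs — it is the socket's
assembly, not its payment; `sock_S10_stabilisedAtEvp₂` stays OPEN in Lines B until typ4's edition plugs ★ payers into these binders; HC_CM is proved only modulo the 7 printed citations
(2 remaining named inputs: hLiu418 = `stmt-HodgeConjecture-24832`, h413 = `stmt-HodgeConjecture-24833`) until rung 0 closes; REL ≠ ★ ≠ BUILT.
-/

set_option autoImplicit false
set_option linter.dupNamespace false

noncomputable section

open scoped RestrictedProduct Matrix MatrixGroups ComplexConjugate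
open Filter MeasureTheory NumberField IsDedekindDomain CompactlySupported
open Literature.NumberTheory.Rogawski1990 Literature.NumberTheory.Automorphic Literature.NumberTheory.Automorphic.UnitaryGroup
open Literature.NumberTheory.Automorphic.UnitaryGroup.CotangentForms Literature.NumberTheory.GaloisRepresentations
open Literature.NumberTheory.Automorphic.Arthur2013.Leaves.TECR
open Summit.HodgeConjecture.HodgeConjecture.Cruxes.H413
open Summit.HodgeConjecture.HodgeConjecture.Cruxes.H413.K2E1TraceFormulaBeta
open Summit.HodgeConjecture.HodgeConjecture.Cruxes.H413.K2E1SpectralTermsDiscreteHalf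
open Summit.HodgeConjecture.HodgeConjecture.Cruxes.H413.K2E1EvpOfAutomorphicClass
open Summit.HodgeConjecture.HodgeConjecture.Cruxes.H413.K2E1GlobalTestFunctions
open Summit.HodgeConjecture.HodgeConjecture.Cruxes.H413.F0P3ClassTokenChoice

namespace Summit.HodgeConjecture.HodgeConjecture.R90.S10

section Keystone

variable {L : Type} [Field L] [NumberField L] [IsCMField L] [DecidableEq (Pl L)] {μ : HeckeCharacter L} {v : Pl L}
  [MeasurableSpace (HLoc L v)] [BorelSpace (HLoc L v)] [MeasurableSpace (Gqs L v)] [BorelSpace (Gqs L v)]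
  {νHv : Measure (HLoc L v)} {νQv : Measure (Gqs L v)} [νHv.IsHaarMeasure] [νHv.IsMulRightInvariant] [νQv.IsHaarMeasure] [νQv.IsMulRightInvariant]
  [∀ a : HLoc L v, MeasurableSpace (HLoc L v ⧸ Subgroup.centralizer ({a} : Set (HLoc L v)))]
  [∀ a : HLoc L v, BorelSpace (HLoc L v ⧸ Subgroup.centralizer ({a} : Set (HLoc L v)))]
  [∀ γ : Gqs L v, MeasurableSpace (Gqs L v ⧸ Subgroup.centralizer ({γ} : Set (Gqs L v)))]
  [∀ γ : Gqs L v, BorelSpace (Gqs L v ⧸ Subgroup.centralizer ({γ} : Set (Gqs L v)))]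
  {mHv : OrbitalMeasureFamily (HLoc L v)} {mQv : OrbitalMeasureFamily (Gqs L v)} {πSt : IrrClass (HLoc L v)}
  [MeasurableSpace (G3 L).Adelic] [BorelSpace (G3 L).Adelic] [MeasurableSpace (H2 L).Adelic] [BorelSpace (H2 L).Adelic]
  [MeasurableSpace (GArch L)] [BorelSpace (GArch L)] [MeasurableSpace (HArch L)] [BorelSpace (HArch L)]
  [MeasurableSpace (H1Loc L v)] [MeasurableSpace (H1Arch L)] [MeasurableSpace (H1 L).Adelic] [BorelSpace (H1 L).Adelic]
  {CuspG : ArchOrbFamG L → (L →+* ℂ) → (GArch L → ℂ) → Prop} {CuspH : ArchOrbFamH L → (L →+* ℂ) → (HArch L → ℂ) → Prop}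

/-! ## §0 FILE D's two-place composition, abstractly: (D1)₂ + `θ_G = dG` + the two germ expansions + the five pins + the two readings ⟹ `D = ½ · H` -/

/-- **FILE D §3+§5 IN ONE ABSTRACT LEMMA** (Lines D `stabilisedAtEvp_of_tfBlocks₂`, re-proved here because Theorems never import Lines): for germs `Germ`, unramified tests `Unr` with the test
pairing `hat` satisfying the five Langlands pins, and — at ONE matched pair, as functions of the unramified test `u` — the values `θG u`, `dG u`, `SθH u` with (D1)₂ `θG u − ½ SθH u = 0`,
`θG u = dG u`, the germ expansions `dG u = Σ'_t cD t · hat t u`, `SθH u = Σ'_t cH t · hat t u` (summable), and the readings `cD t₀ = D`, `cH t₀ = H`: then `D = ½ · H`.  PROOF: the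
series `Σ'_t (cD t − ½ cH t) · hat t u` vanishes for every `u`; ★ `Literature.Topology.separation_of_injective_bounded_starClosed` («separating by Hecke eigenvalues») gives
`cD t₀ − ½ cH t₀ = 0`. [cite: Rogawski1990, §13.8 display (13.8.3) p. 218; §13.7 p. 211; §13.6 Prop. 13.6.2 pp. 209–210] [cite: Langlands1980, pp. 208–211] -/
theorem eq_half_mul_of_tfBlocks {Germ Unr : Type*} (hat : Germ → Unr → ℂ)
    (hinj : Function.Injective hat) (hbdd : ∀ f : Unr, ∃ C : ℝ, ∀ t : Germ, ‖hat t f‖ ≤ C)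
    (hmul : ∀ f g : Unr, ∃ h : Unr, ∀ t : Germ, hat t h = hat t f * hat t g)
    (hstar : ∀ f : Unr, ∃ g : Unr, ∀ t : Germ, hat t g = (starRingEnd ℂ) (hat t f)) (hone : ∃ e : Unr, ∀ t : Germ, hat t e = 1)
    (θG dG SθH : Unr → ℂ) (cD cH : Germ → ℂ) (t₀ : Germ) {D H : ℂ}
    (hD1 : ∀ u, θG u - (1 / 2 : ℂ) * SθH u = 0) (hθ : ∀ u, θG u = dG u)
    (hd : ∀ u, (Summable fun t => cD t * hat t u) ∧ dG u = ∑' t, cD t * hat t u)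
    (hH : ∀ u, (Summable fun t => cH t * hat t u) ∧ SθH u = ∑' t, cH t * hat t u)
    (hd4 : cD t₀ = D) (hH4 : cH t₀ = H) : D = (1 / 2 : ℂ) * H := by
  -- (D2): the germ series of `θ_G − ½ SΘ_H`, coefficients `cD t − ½ cH t`, converges and VANISHES for every unramified test
  have hsum : ∀ u, Summable fun t => (cD t - (1 / 2 : ℂ) * cH t) * hat t u := fun u => by
    refine (((hd u).1).sub (((hH u).1).mul_left (1 / 2 : ℂ))).congr fun t => ?_
    ring
  have hzero : ∀ u, ∑' t, (cD t - (1 / 2 : ℂ) * cH t) * hat t u = 0 := fun u => by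
    obtain ⟨hds, hde⟩ := hd u
    obtain ⟨hHs, hHe⟩ := hH u
    have hHs' := hHs.mul_left (1 / 2 : ℂ)
    have hrw : (fun t => (cD t - (1 / 2 : ℂ) * cH t) * hat t u) = fun t => cD t * hat t u - (1 / 2 : ℂ) * (cH t * hat t u) := by
      funext t
      ring
    have e2 : ∑' t, (1 / 2 : ℂ) * (cH t * hat t u) = (1 / 2 : ℂ) * ∑' t, cH t * hat t u := tsum_mul_left
    rw [hrw, hds.tsum_sub hHs', e2, ← hde, ← hHe, ← hθ u]
    exact hD1 u
  -- (D3): separating by Hecke eigenvalues kills the coefficient at `t₀`; (D4): the two readings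
  have h0 := Literature.Topology.separation_of_injective_bounded_starClosed hat hinj hbdd hmul hstar hone
    (fun t => cD t - (1 / 2 : ℂ) * cH t) hsum hzero t₀
  beta_reduce at h0
  rw [hd4, hH4] at h0
  linear_combination h0

/-! ## §1 The core: (D1)–(D4) ⟹ the stabilised identity at `t₀`, at an ED. 1 frozen datum and FILE D's germs `EvpGerm S (HeckeQs L) bd σ` -/

/-- **THE STABILISED IDENTITY AT THE E.V.P. `t₀` FROM ITS NAMED INPUTS (CORE, ED. 1 frozen datum `𝔣'`).**  Data: a level `S` with `v ∈ S ⊆ {v}`, FILE D's twin's germs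
`EvpGerm S (HeckeQs L) bd σ` = `{t // (∀ i x, ‖t i x‖ ≤ bd i x) ∧ ∀ i x, t i (σ i x) = conj (t i x)}` (bounded, star-fixed e.v.p.'s of UNITARY classes, §10.3 p. 159; the five Langlands
pins are DISCHARGED by ★ `unrHatPins_of_restricted S (HeckeQs L) bd σ hσ`) containing every germ of record (`hRepGerm`; at the pins of record ★ `germOfDiscreteClass_mem_germSub`),
the stabilisation carrier `𝔖` (its `θ_G` on ★ `GlobalTestFunction`s, `SΘ_H` on `TH`), the frozen `H`-family `ΦHu`, the discrete part `dG`, the `H`-coefficients `cH`, the germ `t₀`.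
Hypotheses (FILE D's block BODIES, verbatim at the twin's instantiation `Unr := UnrQs L S`, `ΦGu := 𝔣'.𝔳.ΦGu S`, `hat t f := t.1.hat f.1`, `cD := cDOf 𝔣' S evp` ★ (typ2's (D8-1), K2Liu-p13's DEAL #50) at
`evp c := ⟨germOfDiscreteClass S c, hRepGerm c⟩` — D ED. 5's `hd` token (D8-3)): (D1)₂ `hD1` — `θ_G(ΦGu u φ) − ½ · SΘ_H(ΦHu u f^H_v) = 0` on matched pairs [p. 218 L20–L21; §10.3]; `hθ` — `θ_G` IS the discrete
part `dG` on the family (+ the pinned-zero continuous term, D's `ThetaGPinnedHyp … dG 0` token) [(13.6.1), Arthur Thm. 7.1]; (D2-d) `hd` — the discrete part expands in germs with the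
coefficient of record [(13.6.1), §13.7]; (D2-H) `hH` — `SΘ_H` expands in germs [Prop. 13.6.1]; (D4-H) `hH4` — the `H`-coefficient at `t₀` is the packet trace `Σᶠ_j m(ρ_j) Tr ρ_j(𝔳.ΦH f^H_v)`
[Lemma 13.6.3 (a)(b)]; and for (D4-d): ⟪U⟫ `hunr`, «AFA» `hAF`, the LOCAL inputs `hbc` ((P-t₀), ★ `germOfMembersLetter_of_bcSpherical`) and `hex` ((P-rig), ★
`rigidityAtGermLetter_subtype_of_exists_liesOver`), through ★ W1-H2′.  CONCLUSION: Lines C's `StabilisedAtEvpHyp` body at `mOf 𝔣'`, `trGPinned 𝔣'`, `trHPinned 𝔣'` unfolded —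
`Σᶠ_i m(π_i) · Tr [P i](𝔳.ΦG φ) = ½ · Σᶠ_j m(ρ_j) · Tr ρ_j(𝔳.ΦH f^H_v)` (= Lines B's ONE-PLACE socket B1 `sock_S10_stabilisedAtEvp 𝔣'`'s body as well).  PROOF = D's `stabilisedAtEvp_of_tfBlocks₂`
inline: the germ series of `θ_G − ½ SΘ_H` with coefficients `cD_t(φ) − ½ cH_t(f^H_v)` sums to `0` for every unramified test ((D1)₂ + `hθ` + (D2)), Langlands separation (★
`separation_of_injective_bounded_starClosed` on the five ★ pins) kills the coefficient at `t₀`, and the two readings (D4-d) (D4-H) give the identity.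
[cite: Rogawski1990, §13.8 display (13.8.3) p. 218 L5–7, L20–L28, p. 219 L2–L3; §13.6 (13.6.1) p. 208, Props. 13.6.1–13.6.2 pp. 209–210, Lemma 13.6.3 p. 210; §13.7 p. 211; §10.3 p. 159]
[cite: Langlands1980, pp. 208–211] [cite: Arthur1988InvariantTraceFormulaII, Thm. 7.1 p. 538] [cite: FlathCorvallis1979, Thm. 3] -/
theorem stabilisedAtEvp_of_inputs
    (hunr : ∀ w : Pl L, w ≠ v → ∀ W : PlacesOver L w, Algebra.IsUnramifiedAt (𝓞 ↥(maximalRealSubfield L)) W.1.asIdeal ∧ μ.IsUnramifiedAt W.1)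
    (𝔣' : S10FrozenDatum L μ v νHv νQv mHv mQv πSt)
    (hAF : haveI := 𝔣'.𝔤.hμG; AutomorphicFlathAdmissible (↥(maximalRealSubfield L)) L (IsCMField.complexConj L) 3 (qsForm L) 𝔣'.𝔤.μG)
    (S : Set (Pl L)) (hv : v ∈ S) (hS : ∀ w, w ∈ S → w = v)
    (bd : ∀ i : {i : Pl L // i ∉ S}, HeckeQs L i.1 → ℝ) (σ : ∀ i : {i : Pl L // i ∉ S}, HeckeQs L i.1 → HeckeQs L i.1) (hσ : ∀ i, σ i 1 = 1)
    (hRepGerm : haveI := 𝔣'.𝔤.hμG; ∀ c : DiscreteClass (G3 L) 𝔣'.𝔤.μG,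
      (∀ i x, ‖germOfDiscreteClass S c i x‖ ≤ bd i x) ∧ ∀ i x, germOfDiscreteClass S c i (σ i x) = (starRingEnd ℂ) (germOfDiscreteClass S c i x))
    {TH : Type*} (𝔖 : StabilisationData (GlobalTestFunction L 3 (qsForm L)) TH) (ΦHu : UnrQs L S → (HLoc L v → ℂ) → TH)
    (dG : GlobalTestFunction L 3 (qsForm L) → ℂ) (cH : {t : Ch13Sec6.EigenvaluePackage S (HeckeQs L) // (∀ i x, ‖t i x‖ ≤ bd i x) ∧ ∀ i x, t i (σ i x) = (starRingEnd ℂ) (t i x)} → (HLoc L v → ℂ) → ℂ)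
    (t₀ : {t : Ch13Sec6.EigenvaluePackage S (HeckeQs L) // (∀ i x, ‖t i x‖ ≤ bd i x) ∧ ∀ i x, t i (σ i x) = (starRingEnd ℂ) (t i x)})
    -- (D1)₂ two-place stabilised vanishing on the frozen family (S6)
    (hD1 : ∀ (u : UnrQs L S) (fH : HLoc L v → ℂ) (φ : Gqs L v → ℂ), MatchE1 L μ v mHv mQv fH φ →
      𝔖.θG (𝔣'.𝔳.ΦGu S u φ) - (1 / 2 : ℂ) * 𝔖.SθH (ΦHu u fH) = 0)
    -- `θ_G` is its discrete part on the family (S8 (V-G)), continuous term pinned to `0`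
    (hθ : ∀ (u : UnrQs L S) (φ : Gqs L v → ℂ), 𝔖.θG (𝔣'.𝔳.ΦGu S u φ) = dG (𝔣'.𝔳.ΦGu S u φ) + (0 : GlobalTestFunction L 3 (qsForm L) → ℂ) (𝔣'.𝔳.ΦGu S u φ))
    -- (D2-d) the discrete germ expansion at the germ coefficient OF RECORD (row 3)
    (hd : haveI := 𝔣'.𝔤.hμG; haveI := 𝔣'.𝔤.hνG; ∀ (u : UnrQs L S) (fH : HLoc L v → ℂ) (φ : Gqs L v → ℂ), MatchE1 L μ v mHv mQv fH φ →
      (Summable fun t : {t : Ch13Sec6.EigenvaluePackage S (HeckeQs L) // (∀ i x, ‖t i x‖ ≤ bd i x) ∧ ∀ i x, t i (σ i x) = (starRingEnd ℂ) (t i x)} =>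
        cDOf 𝔣' S (fun c => (⟨germOfDiscreteClass S c, hRepGerm c⟩ : {t : Ch13Sec6.EigenvaluePackage S (HeckeQs L) // (∀ i x, ‖t i x‖ ≤ bd i x) ∧ ∀ i x, t i (σ i x) = (starRingEnd ℂ) (t i x)})) t φ * t.1.hat u.1) ∧
      dG (𝔣'.𝔳.ΦGu S u φ) = ∑' t : {t : Ch13Sec6.EigenvaluePackage S (HeckeQs L) // (∀ i x, ‖t i x‖ ≤ bd i x) ∧ ∀ i x, t i (σ i x) = (starRingEnd ℂ) (t i x)},
        cDOf 𝔣' S (fun c => (⟨germOfDiscreteClass S c, hRepGerm c⟩ : {t : Ch13Sec6.EigenvaluePackage S (HeckeQs L) // (∀ i x, ‖t i x‖ ≤ bd i x) ∧ ∀ i x, t i (σ i x) = (starRingEnd ℂ) (t i x)})) t φ * t.1.hat u.1)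
    -- (D2-H) the germ expansion of `SΘ_H` on the frozen `H`-family (S5)
    (hH : ∀ (u : UnrQs L S) (fH : HLoc L v → ℂ) (φ : Gqs L v → ℂ), MatchE1 L μ v mHv mQv fH φ →
      (Summable fun t : {t : Ch13Sec6.EigenvaluePackage S (HeckeQs L) // (∀ i x, ‖t i x‖ ≤ bd i x) ∧ ∀ i x, t i (σ i x) = (starRingEnd ℂ) (t i x)} => cH t fH * t.1.hat u.1) ∧
      𝔖.SθH (ΦHu u fH) = ∑' t : {t : Ch13Sec6.EigenvaluePackage S (HeckeQs L) // (∀ i x, ‖t i x‖ ≤ bd i x) ∧ ∀ i x, t i (σ i x) = (starRingEnd ℂ) (t i x)}, cH t fH * t.1.hat u.1)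
    -- (D4-H) the `H`-coefficient at `t₀` is the packet trace (S5)
    (hH4 : haveI := 𝔣'.𝔥.hμH; haveI := 𝔣'.𝔥.hνH; ∀ (fH : HLoc L v → ℂ) (φ : Gqs L v → ℂ), MatchE1 L μ v mHv mQv fH φ →
      cH t₀ fH = ∑ᶠ j, (((𝔣'.𝔥.dρ j).mult).toNat : ℂ) * (𝔣'.𝔥.dρ j).classTrace 𝔣'.𝔥.νH (𝔣'.𝔳.ΦH fH))
    -- (P-t₀)'s local input: every `U(Φ₃)(𝒪_w)`-spherical class lying over `ρ_w` has character `(t₀)_w` (J-PIN ∕ #42's `hbc`)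
    (hbc : ∀ (w : {w : Pl L // w ≠ v}) (hwS : w.1 ∉ S) (πw : IrrClass (Gqs L w.1)) (hsph : πw.IsSpherical (cmLocalIntegralLevel L 3 (qsForm L) w.1)),
      LiesOver L μ w.1 (𝔣'.𝔳.K w.1) (𝔣'.𝔥.KH w.1) (𝔣'.𝔳.νQ w) (𝔣'.𝔳.νHw w) (𝔣'.𝔳.mH w) (𝔣'.𝔳.mQ w) πw (𝔣'.𝔥.ρ w.1) →
        unopClassSphericalCharacter (cmLocalIntegralLevel L 3 (qsForm L) w.1) πw hsph = t₀.1 ⟨w.1, hwS⟩)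
    -- (P-rig)'s local input: the ∃-form «`ξ_H(ρ_w)` exists with character `(t₀)_w`» (#26's `hex`)
    (hex : ∀ (w : {w : Pl L // w ≠ v}) (hwS : w.1 ∉ S), ∃ π₀ : IrrClass (Gqs L w.1), π₀.IsAdmissible ∧ ∃ h₀ : π₀.IsSpherical (cmLocalIntegralLevel L 3 (qsForm L) w.1),
      unopClassSphericalCharacter (cmLocalIntegralLevel L 3 (qsForm L) w.1) π₀ h₀ = t₀.1 ⟨w.1, hwS⟩ ∧
        LiesOver L μ w.1 (𝔣'.𝔳.K w.1) (𝔣'.𝔥.KH w.1) (𝔣'.𝔳.νQ w) (𝔣'.𝔳.νHw w) (𝔣'.𝔳.mH w) (𝔣'.𝔳.mQ w) π₀ (𝔣'.𝔥.ρ w.1)) :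
    haveI := 𝔣'.𝔤.hμG
    haveI := 𝔣'.𝔤.hνG
    haveI := 𝔣'.𝔥.hμH
    haveI := 𝔣'.𝔥.hνH
    ∀ (fH : HLoc L v → ℂ) (φ : Gqs L v → ℂ), MatchE1 L μ v mHv mQv fH φ →
      ∑ᶠ i : 𝔣'.𝔤.ι, ((((DiscreteClass.mk (𝔣'.𝔤.P i)).mult).toNat : ℕ) : ℂ) * (DiscreteClass.mk (𝔣'.𝔤.P i)).classTrace 𝔣'.𝔤.νG (𝔣'.𝔳.ΦG φ) =
        (1 / 2 : ℂ) * ∑ᶠ j, (((𝔣'.𝔥.dρ j).mult).toNat : ℂ) * (𝔣'.𝔥.dρ j).classTrace 𝔣'.𝔥.νH (𝔣'.𝔳.ΦH fH) := by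
  haveI := 𝔣'.𝔤.hμG
  haveI := 𝔣'.𝔤.hνG
  haveI := 𝔣'.𝔥.hμH
  haveI := 𝔣'.𝔥.hνH
  -- the two e.v.p. pins at the germ map of record, then (D4-d) by ★ W1-H2′
  have ht₀ : GermOfMembersLetter 𝔣' (fun c => (⟨germOfDiscreteClass S c, hRepGerm c⟩ : {t : Ch13Sec6.EigenvaluePackage S (HeckeQs L) // (∀ i x, ‖t i x‖ ≤ bd i x) ∧ ∀ i x, t i (σ i x) = (starRingEnd ℂ) (t i x)})) t₀ :=
    germOfMembersLetter_of_bcSpherical L μ v νHv νQv mHv mQv πSt 𝔣' S hv hRepGerm t₀ hbc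
  have hrig : RigidityAtGermLetter 𝔣' (fun c => (⟨germOfDiscreteClass S c, hRepGerm c⟩ : {t : Ch13Sec6.EigenvaluePackage S (HeckeQs L) // (∀ i x, ‖t i x‖ ≤ bd i x) ∧ ∀ i x, t i (σ i x) = (starRingEnd ℂ) (t i x)})) t₀ :=
    rigidityAtGermLetter_subtype_of_exists_liesOver hunr 𝔣' hAF S hv hS hRepGerm t₀ hex
  -- (D4-d) at the coefficient of record `cDOf` (★ W1-H2′; `cDOf` unfolds to its left side by `rfl`)
  have hd4 : ∀ (fH : HLoc L v → ℂ) (φ : Gqs L v → ℂ), MatchE1 L μ v mHv mQv fH φ →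
      cDOf 𝔣' S (fun c => (⟨germOfDiscreteClass S c, hRepGerm c⟩ : {t : Ch13Sec6.EigenvaluePackage S (HeckeQs L) // (∀ i x, ‖t i x‖ ≤ bd i x) ∧ ∀ i x, t i (σ i x) = (starRingEnd ℂ) (t i x)})) t₀ φ =
        ∑ᶠ i : 𝔣'.𝔤.ι, (((DiscreteClass.mk (𝔣'.𝔤.P i)).mult).toNat : ℂ) * (DiscreteClass.mk (𝔣'.𝔤.P i)).classTrace 𝔣'.𝔤.νG (𝔣'.𝔳.ΦG φ) :=
    discreteCoeffAtT0_frozenFamily_unrUnit_of_letters 𝔣' S t₀ _ ht₀ hrig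
  intro fH φ hM
  obtain ⟨hinj, hbdd, hmul, hstar, hone⟩ := unrHatPins_of_restricted S (HeckeQs L) bd σ hσ
  -- §0 at this matched pair, as functions of the unramified test `u` (the four block inputs are fed as GOALS: inline lambdas make the elaborator unify against
  -- not-yet-instantiated binder types and unfold `Summable`∕`tsum` — measured; goal-by-goal `exact` is instant)
  refine eq_half_mul_of_tfBlocks (fun t f => t.1.hat f.1) hinj hbdd hmul hstar hone
    (fun u => 𝔖.θG (𝔣'.𝔳.ΦGu S u φ)) (fun u => dG (𝔣'.𝔳.ΦGu S u φ)) (fun u => 𝔖.SθH (ΦHu u fH))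
    (fun t => cDOf 𝔣' S (fun c => (⟨germOfDiscreteClass S c, hRepGerm c⟩ : {t : Ch13Sec6.EigenvaluePackage S (HeckeQs L) // (∀ i x, ‖t i x‖ ≤ bd i x) ∧ ∀ i x, t i (σ i x) = (starRingEnd ℂ) (t i x)})) t φ) (fun t => cH t fH) t₀
    ?_ ?_ ?_ ?_ (hd4 fH φ hM) (hH4 fH φ hM)
  · intro u; exact hD1 u fH φ hM
  · intro u; exact (hθ u φ).trans (add_zero _)
  · intro u; exact hd u fH φ hM
  · intro u; exact hH u fH φ hM

/-! ## §2 The keystone for a two-place frozen datum at FILE D's germs `EvpGerm S (HeckeQs L) bd σ` (pins discharged) -/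

/-- **THE S10 KEYSTONE — `Sock₂Sig 𝔣` FROM ITS NAMED INPUTS** for a two-place frozen datum `𝔣 : S10FrozenDatum₂ …` (any cusp-pin instance `CuspG CuspH`; the socket of record has
S2's `CuspG₀ ∕ CuspH₀`), at FILE D's twin's germs `EvpGerm S (HeckeQs L) bd σ`, the fin-component head keyed on E1's 12R3 `h12 : CmResidualSpectrumCompactR L 3 𝔣.𝔤.μG` («AFA» by ★
`R90.S5.automorphicFlathAdmissible_qs_of_residualCompactR`).  Conclusion = Lines B's `Sock₂Sig 𝔣` unfolded at the
projection `𝔣.toS10FrozenDatum` (defeq through `sock₂Sig_iff`, `StabilisedAtEvpHyp`, `mOf`, `trGPinned`, `trHPinned`, `classTraceAt`, `weightedCutSum` — plain `def`s), so Lines B ED. 4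
pays `sock_S10_stabilisedAtEvp₂ 𝔣 := sock₂Sig_of_inputs 𝔣 …` by `exact` once every binder has a ★ payer.  Binders = §1's at `𝔣' := 𝔣.toS10FrozenDatum`.
[cite: Rogawski1990, §13.8 display (13.8.3) p. 218 L5–7, L20–L28, p. 219 L2–L3; §13.6 (13.6.1) p. 208, Props. 13.6.1–13.6.2 pp. 209–210, Lemma 13.6.3 p. 210; §13.7 p. 211; §10.3 p. 159]
[cite: Langlands1980, pp. 208–211] [cite: Arthur1988InvariantTraceFormulaII, Thm. 7.1 p. 538] [cite: FlathCorvallis1979, Thm. 3] -/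
theorem sock₂Sig_of_inputs
    (hunr : ∀ w : Pl L, w ≠ v → ∀ W : PlacesOver L w, Algebra.IsUnramifiedAt (𝓞 ↥(maximalRealSubfield L)) W.1.asIdeal ∧ μ.IsUnramifiedAt W.1)
    (𝔣 : S10FrozenDatum₂ L μ v νHv νQv mHv mQv πSt CuspG CuspH)
    (h12 : @K2E1CuspidalSpectrumUnitary.CmResidualSpectrumCompactR L _ _ _ 3 𝔣.toS10FrozenDatum.𝔤.μG 𝔣.toS10FrozenDatum.𝔤.hμG)
    (S : Set (Pl L)) (hv : v ∈ S) (hS : ∀ w, w ∈ S → w = v)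
    (bd : ∀ i : {i : Pl L // i ∉ S}, HeckeQs L i.1 → ℝ) (σ : ∀ i : {i : Pl L // i ∉ S}, HeckeQs L i.1 → HeckeQs L i.1) (hσ : ∀ i, σ i 1 = 1)
    (hRepGerm : haveI := 𝔣.toS10FrozenDatum.𝔤.hμG; ∀ c : DiscreteClass (G3 L) 𝔣.toS10FrozenDatum.𝔤.μG,
      (∀ i x, ‖germOfDiscreteClass S c i x‖ ≤ bd i x) ∧ ∀ i x, germOfDiscreteClass S c i (σ i x) = (starRingEnd ℂ) (germOfDiscreteClass S c i x))
    {TH : Type*} (𝔖 : StabilisationData (GlobalTestFunction L 3 (qsForm L)) TH) (ΦHu : UnrQs L S → (HLoc L v → ℂ) → TH)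
    (dG : GlobalTestFunction L 3 (qsForm L) → ℂ)
    (cH : {t : Ch13Sec6.EigenvaluePackage S (HeckeQs L) // (∀ i x, ‖t i x‖ ≤ bd i x) ∧ ∀ i x, t i (σ i x) = (starRingEnd ℂ) (t i x)} → (HLoc L v → ℂ) → ℂ)
    (t₀ : {t : Ch13Sec6.EigenvaluePackage S (HeckeQs L) // (∀ i x, ‖t i x‖ ≤ bd i x) ∧ ∀ i x, t i (σ i x) = (starRingEnd ℂ) (t i x)})
    (hD1 : ∀ (u : UnrQs L S) (fH : HLoc L v → ℂ) (φ : Gqs L v → ℂ), MatchE1 L μ v mHv mQv fH φ →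
      𝔖.θG (𝔣.toS10FrozenDatum.𝔳.ΦGu S u φ) - (1 / 2 : ℂ) * 𝔖.SθH (ΦHu u fH) = 0)
    (hθ : ∀ (u : UnrQs L S) (φ : Gqs L v → ℂ), 𝔖.θG (𝔣.toS10FrozenDatum.𝔳.ΦGu S u φ) =
      dG (𝔣.toS10FrozenDatum.𝔳.ΦGu S u φ) + (0 : GlobalTestFunction L 3 (qsForm L) → ℂ) (𝔣.toS10FrozenDatum.𝔳.ΦGu S u φ))
    (hd : haveI := 𝔣.toS10FrozenDatum.𝔤.hμG; haveI := 𝔣.toS10FrozenDatum.𝔤.hνG;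
      ∀ (u : UnrQs L S) (fH : HLoc L v → ℂ) (φ : Gqs L v → ℂ), MatchE1 L μ v mHv mQv fH φ →
      (Summable fun t : {t : Ch13Sec6.EigenvaluePackage S (HeckeQs L) // (∀ i x, ‖t i x‖ ≤ bd i x) ∧ ∀ i x, t i (σ i x) = (starRingEnd ℂ) (t i x)} =>
        cDOf 𝔣.toS10FrozenDatum S (fun c => (⟨germOfDiscreteClass S c, hRepGerm c⟩ : {t : Ch13Sec6.EigenvaluePackage S (HeckeQs L) // (∀ i x, ‖t i x‖ ≤ bd i x) ∧ ∀ i x, t i (σ i x) = (starRingEnd ℂ) (t i x)})) t φ * t.1.hat u.1) ∧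
      dG (𝔣.toS10FrozenDatum.𝔳.ΦGu S u φ) = ∑' t : {t : Ch13Sec6.EigenvaluePackage S (HeckeQs L) // (∀ i x, ‖t i x‖ ≤ bd i x) ∧ ∀ i x, t i (σ i x) = (starRingEnd ℂ) (t i x)},
        cDOf 𝔣.toS10FrozenDatum S (fun c => (⟨germOfDiscreteClass S c, hRepGerm c⟩ : {t : Ch13Sec6.EigenvaluePackage S (HeckeQs L) // (∀ i x, ‖t i x‖ ≤ bd i x) ∧ ∀ i x, t i (σ i x) = (starRingEnd ℂ) (t i x)})) t φ * t.1.hat u.1)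
    (hH : ∀ (u : UnrQs L S) (fH : HLoc L v → ℂ) (φ : Gqs L v → ℂ), MatchE1 L μ v mHv mQv fH φ →
      (Summable fun t : {t : Ch13Sec6.EigenvaluePackage S (HeckeQs L) // (∀ i x, ‖t i x‖ ≤ bd i x) ∧ ∀ i x, t i (σ i x) = (starRingEnd ℂ) (t i x)} =>
        cH t fH * t.1.hat u.1) ∧
      𝔖.SθH (ΦHu u fH) = ∑' t : {t : Ch13Sec6.EigenvaluePackage S (HeckeQs L) // (∀ i x, ‖t i x‖ ≤ bd i x) ∧ ∀ i x, t i (σ i x) = (starRingEnd ℂ) (t i x)},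
        cH t fH * t.1.hat u.1)
    (hH4 : haveI := 𝔣.toS10FrozenDatum.𝔥.hμH; haveI := 𝔣.toS10FrozenDatum.𝔥.hνH;
      ∀ (fH : HLoc L v → ℂ) (φ : Gqs L v → ℂ), MatchE1 L μ v mHv mQv fH φ →
      cH t₀ fH = ∑ᶠ j, (((𝔣.toS10FrozenDatum.𝔥.dρ j).mult).toNat : ℂ) * (𝔣.toS10FrozenDatum.𝔥.dρ j).classTrace 𝔣.toS10FrozenDatum.𝔥.νH (𝔣.toS10FrozenDatum.𝔳.ΦH fH))
    (hbc : ∀ (w : {w : Pl L // w ≠ v}) (hwS : w.1 ∉ S) (πw : IrrClass (Gqs L w.1)) (hsph : πw.IsSpherical (cmLocalIntegralLevel L 3 (qsForm L) w.1)),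
      LiesOver L μ w.1 (𝔣.toS10FrozenDatum.𝔳.K w.1) (𝔣.toS10FrozenDatum.𝔥.KH w.1) (𝔣.toS10FrozenDatum.𝔳.νQ w) (𝔣.toS10FrozenDatum.𝔳.νHw w)
        (𝔣.toS10FrozenDatum.𝔳.mH w) (𝔣.toS10FrozenDatum.𝔳.mQ w) πw (𝔣.toS10FrozenDatum.𝔥.ρ w.1) →
        unopClassSphericalCharacter (cmLocalIntegralLevel L 3 (qsForm L) w.1) πw hsph = t₀.1 ⟨w.1, hwS⟩)
    (hex : ∀ (w : {w : Pl L // w ≠ v}) (hwS : w.1 ∉ S), ∃ π₀ : IrrClass (Gqs L w.1), π₀.IsAdmissible ∧ ∃ h₀ : π₀.IsSpherical (cmLocalIntegralLevel L 3 (qsForm L) w.1),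
      unopClassSphericalCharacter (cmLocalIntegralLevel L 3 (qsForm L) w.1) π₀ h₀ = t₀.1 ⟨w.1, hwS⟩ ∧
        LiesOver L μ w.1 (𝔣.toS10FrozenDatum.𝔳.K w.1) (𝔣.toS10FrozenDatum.𝔥.KH w.1) (𝔣.toS10FrozenDatum.𝔳.νQ w) (𝔣.toS10FrozenDatum.𝔳.νHw w)
          (𝔣.toS10FrozenDatum.𝔳.mH w) (𝔣.toS10FrozenDatum.𝔳.mQ w) π₀ (𝔣.toS10FrozenDatum.𝔥.ρ w.1)) :
    haveI := 𝔣.toS10FrozenDatum.𝔤.hμG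
    haveI := 𝔣.toS10FrozenDatum.𝔤.hνG
    haveI := 𝔣.toS10FrozenDatum.𝔥.hμH
    haveI := 𝔣.toS10FrozenDatum.𝔥.hνH
    ∀ (fH : HLoc L v → ℂ) (φ : Gqs L v → ℂ), MatchE1 L μ v mHv mQv fH φ →
      ∑ᶠ i : 𝔣.toS10FrozenDatum.𝔤.ι, ((((DiscreteClass.mk (𝔣.toS10FrozenDatum.𝔤.P i)).mult).toNat : ℕ) : ℂ) *
          (DiscreteClass.mk (𝔣.toS10FrozenDatum.𝔤.P i)).classTrace 𝔣.toS10FrozenDatum.𝔤.νG (𝔣.toS10FrozenDatum.𝔳.ΦG φ) =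
        (1 / 2 : ℂ) * ∑ᶠ j, (((𝔣.toS10FrozenDatum.𝔥.dρ j).mult).toNat : ℂ) *
          (𝔣.toS10FrozenDatum.𝔥.dρ j).classTrace 𝔣.toS10FrozenDatum.𝔥.νH (𝔣.toS10FrozenDatum.𝔳.ΦH fH) := by
  -- §1 at the projection `𝔣.toS10FrozenDatum`; the seven by-value inputs are fed as goals (first-order, instant)
  refine stabilisedAtEvp_of_inputs hunr 𝔣.toS10FrozenDatum
    (@R90.S5.automorphicFlathAdmissible_qs_of_residualCompactR L _ _ _ 𝔣.toS10FrozenDatum.𝔤.μG 𝔣.toS10FrozenDatum.𝔤.hμG h12) S hv hS bd σ hσ hRepGerm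
    𝔖 ΦHu dG cH t₀ ?_ ?_ ?_ ?_ ?_ ?_ ?_
  exacts [hD1, hθ, hd, hH, hH4, hbc, hex]

end Keystone

end Summit.HodgeConjecture.HodgeConjecture.R90.S10

end
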